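import Summits.Parity.GeneralizedHardyLittlewood.Theorems.PrimeLevelFamEdgeMomentsBeyondDiagonalDiagRemMonomials
import HarnessLib

/-!
# Route `PrimeLevelFamEdge`, crux K_A `MomentsBeyondDiagonal` (stmt-Parity-20007), line «petersson_layers» v4, stub `stub_diag`:
# **the generic `L^p` remainder monomial: `|Σ a₁a₂ℓ⁺^{m₁}ℓ⁺^{m₂}(2β+ℓ⁺₁+ℓ⁺₂)^p·R| ≤ (4Λ)^p·log^{m₁+m₂}Y·Ψ` for EVERY `p`**

First brick (R1) of the generic remainder estimate (R_ij) of the census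
`Cruxes/MomentsBeyondDiagonal/Lines/petersson_layers_stub_diag_g19_generic_assembly.md` (after `…DiagGenericAssembly.subDiag_of_genericRemainder`,
`stub_diag` follows from the (R_ij) alone). In the remainder weight of order `(i,j)` every monomial carries a power `L^p`,
`L = log(Q²/(g²k₁k₂)) = 2β + ℓ⁺(k₁) + ℓ⁺(k₂)` (`β = log Q − log g − log Y`, `ℓ⁺ = ellp Y`); the per-order files expanded these powers by hand
(`…DiagRemMonomials.abs_monomial_weight_le`, `p ≤ 2`; `…DiagRemFourFourMonomials`, `p ≤ 9`). Here, once for all `p`: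

* `sum_choose_mul_two_pow` / `sum_choose_mul_three_pow` — `Σ_u C(w,u)2^u = 3^w`, `Σ_w C(p,w)3^w = 4^p`;
* `abs_monomial_Lpow_le` — **if every family sum `Σ_{k₁,k₂≤Y} a₁(k₁)a₂(k₂)ℓ⁺(k₁)ⁱℓ⁺(k₂)ʲR(αk₁k₂)` (`i, j ≥ 1`) is `≤ logⁱ⁺ʲY·Ψ`, then for
  all `p` and `m₁, m₂ ≥ 1`: `|Σ a₁a₂ℓ⁺^{m₁}ℓ⁺^{m₂}·((2β+ℓ⁺₁+ℓ⁺₂)^p·R(αk₁k₂))| ≤ (4Λ)^p·log^{m₁+m₂}Y·Ψ`** (`|β| ≤ Λ`, `0 ≤ log Y ≤ Λ`, `1 ≤ Λ`).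

Def-free; theorems only. Helper `--supports stmt-Parity-20007`; closes nothing; K_A, K_B and the Parity summit are NOT proved;
nothing about Landau–Siegel zeros.

## References
* E. Kowalski, P. Michel, J. VanderKam, J. reine angew. Math. 526 (2000), (22)–(28) pp. 12–15 and Prop. 5.1 p. 18.
  [cite: KowalskiMichelVanderKam2000, Prop. 5.1 — derivation (remainder weights of the diagonal, one monomial, every power of L)]
-/

noncomputable section

open Finset Real

namespace Summit.Parity.GeneralizedHardyLittlewood.Theorems.MomentsBeyondDiagonal.DiagCorner

open Summit.Parity.GeneralizedHardyLittlewood.Theorems.BeyondDiagonalBeatsQuarter.Corner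

/-- `Σ_{u ≤ w} C(w,u)·2^u = 3^w`. [folklore] -/
theorem sum_choose_mul_two_pow (w : ℕ) :
    ∑ u ∈ range (w + 1), (w.choose u : ℝ) * 2 ^ u = 3 ^ w := by
  rw [show (3 : ℝ) = 2 + 1 by norm_num, add_pow]
  refine Finset.sum_congr rfl fun u _ ↦ ?_
  rw [one_pow, mul_one, mul_comm]

/-- `Σ_{w ≤ p} C(p,w)·3^w = 4^p`. [folklore] -/
theorem sum_choose_mul_three_pow (p : ℕ) :
    ∑ w ∈ range (p + 1), (p.choose w : ℝ) * 3 ^ w = 4 ^ p := by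
  rw [show (4 : ℝ) = 3 + 1 by norm_num, add_pow]
  refine Finset.sum_congr rfl fun w _ ↦ ?_
  rw [one_pow, mul_one, mul_comm]

/-- **The generic `L^p` remainder monomial** (see the module docstring).
[cite: KowalskiMichelVanderKam2000, Prop. 5.1 — derivation (remainder weights of the diagonal, one monomial, every power of L)] -/
theorem abs_monomial_Lpow_le (p : ℕ) {a₁ a₂ : ℕ → ℝ} {R : ℝ → ℝ} {Y α β Λ Ψ : ℝ} {m₁ m₂ : ℕ}
    (hm₁ : 1 ≤ m₁) (hm₂ : 1 ≤ m₂) (hΛ : 1 ≤ Λ) (hβ : |β| ≤ Λ) (hLY0 : 0 ≤ Real.log Y) (hLY : Real.log Y ≤ Λ)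
    (hΨ : 0 ≤ Ψ)
    (hR : ∀ i j : ℕ, 1 ≤ i → 1 ≤ j →
      |∑ k₁ ∈ Icc 1 ⌊Y⌋₊, ∑ k₂ ∈ Icc 1 ⌊Y⌋₊,
          a₁ k₁ * a₂ k₂ * ellp Y k₁ ^ i * ellp Y k₂ ^ j * R (α * k₁ * k₂)| ≤ Real.log Y ^ (i + j) * Ψ) :
    |∑ k₁ ∈ Icc 1 ⌊Y⌋₊, ∑ k₂ ∈ Icc 1 ⌊Y⌋₊,
        a₁ k₁ * a₂ k₂ * ellp Y k₁ ^ m₁ * ellp Y k₂ ^ m₂ *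
          ((2 * β + ellp Y k₁ + ellp Y k₂) ^ p * R (α * k₁ * k₂))| ≤
      (4 * Λ) ^ p * (Real.log Y ^ (m₁ + m₂) * Ψ) := by
  have hΛ0 : 0 ≤ Λ := zero_le_one.trans hΛ
  -- pointwise trinomial expansion
  have hexp : ∀ k₁ k₂ : ℕ,
      a₁ k₁ * a₂ k₂ * ellp Y k₁ ^ m₁ * ellp Y k₂ ^ m₂ * ((2 * β + ellp Y k₁ + ellp Y k₂) ^ p * R (α * k₁ * k₂)) =
        ∑ w ∈ range (p + 1), ∑ u ∈ range (w + 1),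
          ((p.choose w : ℝ) * (w.choose u : ℝ) * (2 * β) ^ u) *
            (a₁ k₁ * a₂ k₂ * ellp Y k₁ ^ (m₁ + (w - u)) * ellp Y k₂ ^ (m₂ + (p - w)) * R (α * k₁ * k₂)) := by
    intro k₁ k₂
    simp only [add_pow, Finset.sum_mul, Finset.mul_sum]
    refine Finset.sum_congr rfl fun w _ ↦ Finset.sum_congr rfl fun u _ ↦ ?_
    ring
  rw [Finset.sum_congr rfl fun k₁ _ ↦ Finset.sum_congr rfl fun k₂ _ ↦ hexp k₁ k₂]
  -- move the `(w,u)` sums out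
  rw [Finset.sum_congr rfl fun k₁ _ ↦ Finset.sum_comm, Finset.sum_comm]
  rw [Finset.sum_congr rfl fun w _ ↦ Finset.sum_congr rfl fun k₁ _ ↦ Finset.sum_comm,
    Finset.sum_congr rfl fun w _ ↦ Finset.sum_comm]
  simp_rw [← Finset.mul_sum]
  -- termwise bound
  have hterm : ∀ w ∈ range (p + 1), ∀ u ∈ range (w + 1),
      |((p.choose w : ℝ) * (w.choose u : ℝ) * (2 * β) ^ u) *
          ∑ k₁ ∈ Icc 1 ⌊Y⌋₊, ∑ k₂ ∈ Icc 1 ⌊Y⌋₊,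
            a₁ k₁ * a₂ k₂ * ellp Y k₁ ^ (m₁ + (w - u)) * ellp Y k₂ ^ (m₂ + (p - w)) * R (α * k₁ * k₂)| ≤
        (p.choose w : ℝ) * ((w.choose u : ℝ) * 2 ^ u) * (Λ ^ p * (Real.log Y ^ (m₁ + m₂) * Ψ)) := by
    intro w hw u hu
    have hw' := Finset.mem_range.1 hw
    have hu' := Finset.mem_range.1 hu
    have h1 := hR (m₁ + (w - u)) (m₂ + (p - w)) (by omega) (by omega)
    rw [abs_mul]
    have hcoef : |(p.choose w : ℝ) * (w.choose u : ℝ) * (2 * β) ^ u| ≤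
        (p.choose w : ℝ) * ((w.choose u : ℝ) * 2 ^ u) * Λ ^ u := by
      rw [abs_mul, abs_mul, abs_pow, abs_mul, Nat.abs_cast, Nat.abs_cast, abs_two, mul_pow]
      have : |β| ^ u ≤ Λ ^ u := pow_le_pow_left₀ (abs_nonneg β) hβ u
      calc (p.choose w : ℝ) * (w.choose u : ℝ) * (2 ^ u * |β| ^ u)
          ≤ (p.choose w : ℝ) * (w.choose u : ℝ) * (2 ^ u * Λ ^ u) := by gcongr
        _ = (p.choose w : ℝ) * ((w.choose u : ℝ) * 2 ^ u) * Λ ^ u := by ring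
    have hsum : Real.log Y ^ (m₁ + (w - u) + (m₂ + (p - w))) * Ψ ≤
        Λ ^ ((w - u) + (p - w)) * (Real.log Y ^ (m₁ + m₂) * Ψ) := by
      have e1 : Real.log Y ^ (m₁ + (w - u) + (m₂ + (p - w))) =
          Real.log Y ^ ((w - u) + (p - w)) * Real.log Y ^ (m₁ + m₂) := by
        rw [← pow_add, show w - u + (p - w) + (m₁ + m₂) = m₁ + (w - u) + (m₂ + (p - w)) by omega]
      rw [e1, mul_assoc]
      exact mul_le_mul_of_nonneg_right (pow_le_pow_left₀ hLY0 hLY _) (mul_nonneg (pow_nonneg hLY0 _) hΨ)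
    have hΛp : Λ ^ u * Λ ^ ((w - u) + (p - w)) = Λ ^ p := by
      rw [← pow_add, show u + (w - u + (p - w)) = p by omega]
    calc |(p.choose w : ℝ) * (w.choose u : ℝ) * (2 * β) ^ u| *
          |∑ k₁ ∈ Icc 1 ⌊Y⌋₊, ∑ k₂ ∈ Icc 1 ⌊Y⌋₊,
            a₁ k₁ * a₂ k₂ * ellp Y k₁ ^ (m₁ + (w - u)) * ellp Y k₂ ^ (m₂ + (p - w)) * R (α * k₁ * k₂)|
        ≤ ((p.choose w : ℝ) * ((w.choose u : ℝ) * 2 ^ u) * Λ ^ u) *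
            (Λ ^ ((w - u) + (p - w)) * (Real.log Y ^ (m₁ + m₂) * Ψ)) :=
          mul_le_mul hcoef (h1.trans hsum) (abs_nonneg _) (by positivity)
      _ = (p.choose w : ℝ) * ((w.choose u : ℝ) * 2 ^ u) * ((Λ ^ u * Λ ^ ((w - u) + (p - w))) *
            (Real.log Y ^ (m₁ + m₂) * Ψ)) := by ring
      _ = (p.choose w : ℝ) * ((w.choose u : ℝ) * 2 ^ u) * (Λ ^ p * (Real.log Y ^ (m₁ + m₂) * Ψ)) := by rw [hΛp]
  calc |∑ w ∈ range (p + 1), ∑ u ∈ range (w + 1),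
          ((p.choose w : ℝ) * (w.choose u : ℝ) * (2 * β) ^ u) *
            ∑ k₁ ∈ Icc 1 ⌊Y⌋₊, ∑ k₂ ∈ Icc 1 ⌊Y⌋₊,
              a₁ k₁ * a₂ k₂ * ellp Y k₁ ^ (m₁ + (w - u)) * ellp Y k₂ ^ (m₂ + (p - w)) * R (α * k₁ * k₂)|
      ≤ ∑ w ∈ range (p + 1), ∑ u ∈ range (w + 1),
          |((p.choose w : ℝ) * (w.choose u : ℝ) * (2 * β) ^ u) *
            ∑ k₁ ∈ Icc 1 ⌊Y⌋₊, ∑ k₂ ∈ Icc 1 ⌊Y⌋₊,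
              a₁ k₁ * a₂ k₂ * ellp Y k₁ ^ (m₁ + (w - u)) * ellp Y k₂ ^ (m₂ + (p - w)) * R (α * k₁ * k₂)| := by
        refine (Finset.abs_sum_le_sum_abs _ _).trans (Finset.sum_le_sum fun w _ ↦ Finset.abs_sum_le_sum_abs _ _)
    _ ≤ ∑ w ∈ range (p + 1), ∑ u ∈ range (w + 1),
          (p.choose w : ℝ) * ((w.choose u : ℝ) * 2 ^ u) * (Λ ^ p * (Real.log Y ^ (m₁ + m₂) * Ψ)) :=
        Finset.sum_le_sum fun w hw ↦ Finset.sum_le_sum fun u hu ↦ hterm w hw u hu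
    _ = (∑ w ∈ range (p + 1), (p.choose w : ℝ) * ∑ u ∈ range (w + 1), (w.choose u : ℝ) * 2 ^ u) *
          (Λ ^ p * (Real.log Y ^ (m₁ + m₂) * Ψ)) := by
        rw [Finset.sum_mul]
        refine Finset.sum_congr rfl fun w _ ↦ ?_
        rw [Finset.mul_sum, Finset.sum_mul]
    _ = 4 ^ p * (Λ ^ p * (Real.log Y ^ (m₁ + m₂) * Ψ)) := by
        rw [Finset.sum_congr rfl fun w _ ↦ by rw [sum_choose_mul_two_pow], sum_choose_mul_three_pow]
    _ = (4 * Λ) ^ p * (Real.log Y ^ (m₁ + m₂) * Ψ) := by rw [mul_pow]; ring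

end Summit.Parity.GeneralizedHardyLittlewood.Theorems.MomentsBeyondDiagonal.DiagCorner

end
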